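import Summits.CriticalPhenomena.PercolationContinuityZ3.Theorems.PercNearOneGluingNoHeavyLowerTailMLnaCexChecker

/-!
# `NoHeavyLowerTail` (crux stmt-CriticalPhenomena-4575): the NON-ADJACENT CHAMPION-SHIFT CONDITION (ML-na)
# is FALSE — a certified weighted counterexample on six vertices

The support file `PercNearOneGluingNoHeavyLowerTailCILInductionNonAdjacent.lean` (prover prim-gen-induct,
2026-08-18) reduces the cumulative isolation lemma and the crux `NoHeavyLowerTail` to the hypothesis `hML` of
`setCS_of_MLna` / `noHeavyLowerTail_of_MLna`, the "non-adjacent champion-shift condition" (ML-na): for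
`μ_w = prodBernoulli w` on `Fin n`, relays `A`, level `j`, lightness `I_w(x) = μ_w{|π(x)| ≤ j}`
(`π(x)` = relays joined to `x`), every set `S` of at least two non-relays all strictly LIGHTER than a champion
`c` (a maximiser of `I_w` on `A`) that has no positive pair to `S`, with `S` carrying a positive pair, admits a
nonempty set `F` of positive pairs at `S` and a champion `c_F` of `w^F` (`F` switched off) with
`J_w(S, c_F) ≤ J_w(S, c)` (`J_w(S, x)` = lightness of `x` after gluing `S`).

**THIS FILE SHOWS THAT (ML-na) FAILS ON SIX VERTICES** (exhaustive-census witness of the ttrl engine seat,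
`run/shared/lean/ttrl/mlna/README.md`, series-reduced; re-verified here by brute force and by KERNEL REDUCTION — `decide +kernel`, no `native_decide`,
standard axioms only):

* vertices `Fin 6`, relays `A = {0, 1, 2}`, glued set `S = {3, 4}`, Steiner vertex `5`, level `j = 1`, champion `c = 2`;
* weights `w(0,1) = 3/5`, `w(0,3) = 1/5`, `w(0,4) = 3/10`, `w(0,5) = 2/5`, `w(1,2) = 1/2`, `w(1,3) = 4/5`,
  `w(1,5) = 3/5`, `w(2,5) = 4/5`, `w(4,5) = 9/10`, all other pairs `0`;
* `I(0) = 126777/781250 ≈ 0.1623`, `I(1) = 118797/1562500 ≈ 0.0760`, `I(2) = 1063/6250 ≈ 0.1701` — so `2` is the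
  (unique) champion; `I(3) ≈ 0.2257 > I(2)`, `I(4) ≈ 0.1887 > I(2)` — `S` is light; `w(2,3) = w(2,4) = 0`;
  the positive pairs at `S` are `E_S = {03, 13, 04, 45}`;
* `J(0) = 55143/390625 ≈ 0.1412`, `J(1) ≈ 0.0316`, `J(2) = 18637/156250 ≈ 0.1193`;
* for EVERY nonempty `F ⊆ E_S` the unique champion of `w^F` is the relay `0` (`I_F(0) > I_F(1)`, `I_F(0) > I_F(2)`
  in each of the 15 cases), and `J(0) > J(2)`.

Hence no admissible pair `(F, c_F)` exists: `c_F = 0` violates `J(c_F) ≤ J(c)`, and `c_F ∈ {1, 2}` is never a champion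
of `w^F`.  Mechanism (engine seat): the two `S`-vertices are series vertices on two inter-relay connections avoiding
`c` (`1–3–0` and `0–4–5`); switching any `S`-pair off makes relay `0` strictly lonelier than `c`, while gluing `3 = 4`
costs `c` (tied to `4` through the hub `5`) much more lightness than it costs `0`.  Set-champion stability
`CS_w(S, c)` and the cumulative isolation lemma HOLD at this witness — only the ROUTE through (ML-na) is refuted,
not `stub_cumulativeIsolation` or the crux (coordinator ruling 2026-08-18: ML-na dropped).

Contents (this file = measure side + deliverables; the checker, the witness data and the kernel-checked
arithmetic are in `PercNearOneGluingNoHeavyLowerTailMLnaCexChecker.lean`): the three events of (ML-na) as exact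
weighted counts (`real_light`, `real_jfar`, `real_jnear`), the side conditions at the witness (`wit_03_ne_zero`,
`wit_two_S`), and the deliverables `not_MLna_six` ((ML-na) fails already for `n = 6`, `A = {0,1,2}`, `j = 1` — the
hypothesis `hML` of `setCS_of_MLna` at these parameters, negated) and `not_MLna` (the all-`n` form).
No sorries, no definitions, standard axioms (the arithmetic is kernel `decide`, not `native_decide`).
-/

namespace Summit.CriticalPhenomena.PercolationContinuityZ3.Theorems

open MeasureTheory
open Literature.Probability.LatticeModels Literature.Probability.Percolation
open Summit.CriticalPhenomena.PercolationContinuityZ3.Theorems.AdditiveGluing.Negative.Cert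
open Summit.CriticalPhenomena.PercolationContinuityZ3.Theorems.WorstPairExchangeCex (real_eq_wcount)

namespace MLnaCex

/-! ### The events as exact counts (measure side; classical decidability for the event predicates) -/

open scoped Classical

/-- Per-configuration agreement of the relay count. [this file] -/
theorem nrel_reachTable (ω : List (Fin 6 × Fin 6)) (x : Fin 6) :
    nrel (reachTable 6 ω) x =
      (({0, 1, 2} : Finset (Fin 6)).filter fun z => (↑(Eset ω) : Set (Sym2 (Fin 6))) ∈ openConn x z).card := by
  unfold nrel
  rw [Finset.filter_congr fun z _ => testBit_reachTable_iff_mem_openConn ω x z]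

/-- `I(x) = cntI`. [this file] -/
theorem real_light {l : List (Fin 6 × Fin 6 × ℚ)} (hnd : (wPairs l).Nodup)
    (hq : ∀ e ∈ l, 0 ≤ e.2.2 ∧ e.2.2 ≤ 1) (x : Fin 6) :
    (prodBernoulli (wOfList l)).real
        {ω : BondConfig (Fin 6) |
          (({0, 1, 2} : Finset (Fin 6)).filter fun z => ω ∈ openConn x z).card ≤ 1} = (cntI l x : ℝ) := by
  refine real_eq_wcount hnd hq (fun tb => lightB tb x) _ fun ω => ?_
  simp only [lightB, decide_eq_true_eq, Set.mem_setOf_eq, nrel_reachTable]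

/-- The "far" part of `J(x)` is `cntJfar`. [this file] -/
theorem real_jfar {l : List (Fin 6 × Fin 6 × ℚ)} (hnd : (wPairs l).Nodup)
    (hq : ∀ e ∈ l, 0 ≤ e.2.2 ∧ e.2.2 ≤ 1) (x : Fin 6) :
    (prodBernoulli (wOfList l)).real
        {ω : BondConfig (Fin 6) | (∀ y ∈ ({3, 4} : Finset (Fin 6)), ω ∉ openConn x y) ∧
          (({0, 1, 2} : Finset (Fin 6)).filter fun z => ω ∈ openConn x z).card ≤ 1} = (cntJfar l x : ℝ) := by
  refine real_eq_wcount hnd hq (fun tb => jfarB tb x) _ fun ω => ?_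
  simp only [jfarB, decide_eq_true_eq, Set.mem_setOf_eq, nrel_reachTable, Bool.eq_false_iff, ne_eq,
    testBit_reachTable_iff_mem_openConn]

/-- The "near" part of `J(x)` is `cntJnear`. [this file] -/
theorem real_jnear {l : List (Fin 6 × Fin 6 × ℚ)} (hnd : (wPairs l).Nodup)
    (hq : ∀ e ∈ l, 0 ≤ e.2.2 ∧ e.2.2 ≤ 1) (x : Fin 6) :
    (prodBernoulli (wOfList l)).real
        {ω : BondConfig (Fin 6) | (∃ y ∈ ({3, 4} : Finset (Fin 6)), ω ∈ openConn x y) ∧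
          (({0, 1, 2} : Finset (Fin 6)).filter fun z =>
            ∃ y ∈ ({3, 4} : Finset (Fin 6)), ω ∈ openConn y z).card ≤ 1} = (cntJnear l x : ℝ) := by
  refine real_eq_wcount hnd hq (fun tb => jnearB tb x) _ fun ω => ?_
  simp only [jnearB, decide_eq_true_eq, Set.mem_setOf_eq, testBit_reachTable_iff_mem_openConn]

/-- The weight of the pair `03` is `1/5 ≠ 0`. [this file] -/
theorem wit_03_ne_zero : wOfList wit s(3, 0) ≠ 0 := by
  have h : wOfList wit s(3, 0) = Set.projIcc (0 : ℝ) 1 zero_le_one ((1/5 : ℚ) : ℝ) := by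
    simp [wOfList, wit, mkE]
  rw [h]
  intro h0
  have h1 := congrArg Subtype.val h0
  simp [Set.projIcc] at h1
  norm_num at h1

/-- `c = 2` has no positive pair to `S`: `w(2,3) = w(2,4) = 0`. [this file] -/
theorem wit_two_S (v : Fin 6) (hv : v ∈ ({3, 4} : Finset (Fin 6))) : wOfList wit s(2, v) = 0 := by
  refine wOfList_eq_zero wit _ ?_
  simp only [Finset.mem_insert, Finset.mem_singleton] at hv
  rcases hv with rfl | rfl <;> decide

end MLnaCex

open MLnaCex
open scoped Classical

/-- **(ML-na) fails on six vertices.**  For `n = 6`, relays `A = {0, 1, 2}` and level `j = 1`, the non-adjacent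
champion-shift condition — verbatim the hypothesis `hML` of `setCS_of_MLna` / `cumulativeIsolation_of_MLna` /
`noHeavyLowerTail_of_MLna` (`PercNearOneGluingNoHeavyLowerTailCILInductionNonAdjacent.lean`) at these parameters —
is FALSE: at the witness weights `wit` with `S = {3, 4}`, `c = 2` all four hypotheses hold (`2` is a champion,
`S` is light, `S` carries the positive pair `03`, `w(2,3) = w(2,4) = 0`) but for every nonempty set `F` of positive
pairs at `S` the only champion of `w^F` is the relay `0`, whose glued lightness `J(0) ≈ 0.1412` exceeds
`J(2) ≈ 0.1193`. [this file] -/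
theorem not_MLna_six :
    ¬ (∀ (w : Sym2 (Fin 6) → unitInterval) (S : Finset (Fin 6)) (c : Fin 6),
      Disjoint S ({0, 1, 2} : Finset (Fin 6)) → 2 ≤ S.card → c ∈ ({0, 1, 2} : Finset (Fin 6)) →
      (∀ a ∈ ({0, 1, 2} : Finset (Fin 6)), (prodBernoulli w).real {ω : BondConfig (Fin 6) |
          (({0, 1, 2} : Finset (Fin 6)).filter fun z => ω ∈ openConn a z).card ≤ 1} ≤
        (prodBernoulli w).real {ω : BondConfig (Fin 6) |
          (({0, 1, 2} : Finset (Fin 6)).filter fun z => ω ∈ openConn c z).card ≤ 1}) →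
      (∀ v ∈ S, (prodBernoulli w).real {ω : BondConfig (Fin 6) |
          (({0, 1, 2} : Finset (Fin 6)).filter fun z => ω ∈ openConn c z).card ≤ 1} <
        (prodBernoulli w).real {ω : BondConfig (Fin 6) |
          (({0, 1, 2} : Finset (Fin 6)).filter fun z => ω ∈ openConn v z).card ≤ 1}) →
      (∃ v ∈ S, ∃ y, y ∉ S ∧ w s(v, y) ≠ 0) →
      (∀ v ∈ S, w s(c, v) = 0) →
      ∃ F : Finset (Sym2 (Fin 6)), F.Nonempty ∧ (∀ e ∈ F, w e ≠ 0 ∧ ∃ v ∈ S, ∃ y, y ≠ v ∧ e = s(v, y)) ∧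
        ∃ cF ∈ ({0, 1, 2} : Finset (Fin 6)),
          (∀ a ∈ ({0, 1, 2} : Finset (Fin 6)),
            (prodBernoulli (fun e => if e ∈ F then 0 else w e)).real
                {ω : BondConfig (Fin 6) | (({0, 1, 2} : Finset (Fin 6)).filter fun z => ω ∈ openConn a z).card ≤ 1} ≤
              (prodBernoulli (fun e => if e ∈ F then 0 else w e)).real
                {ω : BondConfig (Fin 6) | (({0, 1, 2} : Finset (Fin 6)).filter fun z => ω ∈ openConn cF z).card ≤ 1}) ∧
          (prodBernoulli w).real {ω : BondConfig (Fin 6) | (∀ y ∈ S, ω ∉ openConn cF y) ∧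
                (({0, 1, 2} : Finset (Fin 6)).filter fun z => ω ∈ openConn cF z).card ≤ 1} +
              (prodBernoulli w).real {ω : BondConfig (Fin 6) | (∃ y ∈ S, ω ∈ openConn cF y) ∧
                (({0, 1, 2} : Finset (Fin 6)).filter fun z => ∃ y ∈ S, ω ∈ openConn y z).card ≤ 1} ≤
            (prodBernoulli w).real {ω : BondConfig (Fin 6) | (∀ y ∈ S, ω ∉ openConn c y) ∧
                (({0, 1, 2} : Finset (Fin 6)).filter fun z => ω ∈ openConn c z).card ≤ 1} +
              (prodBernoulli w).real {ω : BondConfig (Fin 6) | (∃ y ∈ S, ω ∈ openConn c y) ∧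
                (({0, 1, 2} : Finset (Fin 6)).filter fun z => ∃ y ∈ S, ω ∈ openConn y z).card ≤ 1}) := by
  intro h
  obtain ⟨hc0, hc1, hl3, hl4, hJ20⟩ := facts_wit
  -- the four hypotheses at the witness
  have hchamp : ∀ a ∈ ({0, 1, 2} : Finset (Fin 6)), (prodBernoulli (wOfList wit)).real {ω : BondConfig (Fin 6) |
        (({0, 1, 2} : Finset (Fin 6)).filter fun z => ω ∈ openConn a z).card ≤ 1} ≤
      (prodBernoulli (wOfList wit)).real {ω : BondConfig (Fin 6) |
        (({0, 1, 2} : Finset (Fin 6)).filter fun z => ω ∈ openConn (2 : Fin 6) z).card ≤ 1} := by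
    intro a ha
    simp only [Finset.mem_insert, Finset.mem_singleton] at ha
    rcases ha with rfl | rfl | rfl
    · rw [real_light wit_nodup wit_weights, real_light wit_nodup wit_weights]; exact_mod_cast hc0
    · rw [real_light wit_nodup wit_weights, real_light wit_nodup wit_weights]; exact_mod_cast hc1
    · exact le_rfl
  have hlight : ∀ v ∈ ({3, 4} : Finset (Fin 6)), (prodBernoulli (wOfList wit)).real {ω : BondConfig (Fin 6) |
        (({0, 1, 2} : Finset (Fin 6)).filter fun z => ω ∈ openConn (2 : Fin 6) z).card ≤ 1} <
      (prodBernoulli (wOfList wit)).real {ω : BondConfig (Fin 6) |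
        (({0, 1, 2} : Finset (Fin 6)).filter fun z => ω ∈ openConn v z).card ≤ 1} := by
    intro v hv
    simp only [Finset.mem_insert, Finset.mem_singleton] at hv
    rcases hv with rfl | rfl
    · rw [real_light wit_nodup wit_weights, real_light wit_nodup wit_weights]; exact_mod_cast hl3
    · rw [real_light wit_nodup wit_weights, real_light wit_nodup wit_weights]; exact_mod_cast hl4
  have hpos : ∃ v ∈ ({3, 4} : Finset (Fin 6)), ∃ y, y ∉ ({3, 4} : Finset (Fin 6)) ∧ wOfList wit s(v, y) ≠ 0 :=
    ⟨3, by simp, 0, by decide, wit_03_ne_zero⟩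
  obtain ⟨F, hFne, hF, cF, hcF, hchampF, hJ⟩ :=
    h (wOfList wit) {3, 4} 2 (by decide) (by decide) (by decide) hchamp hlight hpos wit_two_S
  -- every pair of `F` is one of the four positive pairs at `S`
  have hFsub : ∀ e ∈ F, e = s(0, 3) ∨ e = s(1, 3) ∨ e = s(0, 4) ∨ e = s(4, 5) := by
    intro e he
    obtain ⟨hne, v, hv, y, hyv, rfl⟩ := hF e he
    have hmem : s(v, y) ∈ wE wit := by
      by_contra hn
      exact hne (wOfList_eq_zero wit _ hn)
    simp only [Finset.mem_insert, Finset.mem_singleton] at hv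
    rcases hv with rfl | rfl
    · rcases pairs_at_three y hyv hmem with h1 | h1 | h1 | h1
      · exact Or.inl h1
      · exact Or.inr (Or.inl h1)
      · exact Or.inr (Or.inr (Or.inl h1))
      · exact Or.inr (Or.inr (Or.inr h1))
    · rcases pairs_at_four y hyv hmem with h1 | h1 | h1 | h1
      · exact Or.inl h1
      · exact Or.inr (Or.inl h1)
      · exact Or.inr (Or.inr (Or.inl h1))
      · exact Or.inr (Or.inr (Or.inr h1))
  have hnot : ∀ e : Sym2 (Fin 6), e ≠ s(0, 3) → e ≠ s(1, 3) → e ≠ s(0, 4) → e ≠ s(4, 5) → e ∉ F := by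
    intro e h1 h2 h3 h4 he
    rcases hFsub e he with h | h | h | h
    · exact h1 h
    · exact h2 h
    · exact h3 h
    · exact h4 h
  have h01 : s(0, 1) ∉ F := hnot _ (by decide) (by decide) (by decide) (by decide)
  have h05 : s(0, 5) ∉ F := hnot _ (by decide) (by decide) (by decide) (by decide)
  have h12 : s(1, 2) ∉ F := hnot _ (by decide) (by decide) (by decide) (by decide)
  have h15 : s(1, 5) ∉ F := hnot _ (by decide) (by decide) (by decide) (by decide)
  have h25 : s(2, 5) ∉ F := hnot _ (by decide) (by decide) (by decide) (by decide)
  -- the switched-off weights are `witB` at the four membership bits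
  set b03 := decide (s(0, 3) ∈ F) with hb03
  set b13 := decide (s(1, 3) ∈ F) with hb13
  set b04 := decide (s(0, 4) ∈ F) with hb04
  set b45 := decide (s(4, 5) ∈ F) with hb45
  have hwF : (fun e => if e ∈ F then 0 else wOfList wit e) = wOfList (witB b03 b13 b04 b45) := by
    rw [hb03, hb13, hb04, hb45, ← zeroOut_wit F h01 h05 h12 h15 h25]
    funext x
    exact (wOfList_zeroOut F wit x).symm
  have hbits : (b03 || b13 || b04 || b45) = true := by
    obtain ⟨e, he⟩ := hFne
    rcases hFsub e he with rfl | rfl | rfl | rfl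
    · have : b03 = true := by rw [hb03]; exact decide_eq_true he
      simp [this]
    · have : b13 = true := by rw [hb13]; exact decide_eq_true he
      simp [this]
    · have : b04 = true := by rw [hb04]; exact decide_eq_true he
      simp [this]
    · have : b45 = true := by rw [hb45]; exact decide_eq_true he
      simp [this]
  obtain ⟨hF1, hF2⟩ := facts_witB b03 b13 b04 b45 hbits
  rw [hwF] at hchampF
  have hndB := witB_nodup b03 b13 b04 b45
  have hqB := witB_weights b03 b13 b04 b45
  -- the three candidates for `c_F`
  simp only [Finset.mem_insert, Finset.mem_singleton] at hcF
  rcases hcF with rfl | rfl | rfl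
  · -- `c_F = 0`: the glued-lightness comparison fails
    rw [real_jfar wit_nodup wit_weights, real_jnear wit_nodup wit_weights,
      real_jfar wit_nodup wit_weights, real_jnear wit_nodup wit_weights] at hJ
    have hJ' : cntJfar wit 0 + cntJnear wit 0 ≤ cntJfar wit 2 + cntJnear wit 2 := by exact_mod_cast hJ
    exact absurd hJ' (not_le.2 hJ20)
  · -- `c_F = 1` is not a champion of `w^F`
    have h10 := hchampF 0 (by simp)
    rw [real_light hndB hqB, real_light hndB hqB] at h10
    have h10' : cntI (witB b03 b13 b04 b45) 0 ≤ cntI (witB b03 b13 b04 b45) 1 := by exact_mod_cast h10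
    exact absurd h10' (not_le.2 hF1)
  · -- `c_F = 2` is not a champion of `w^F`
    have h20 := hchampF 0 (by simp)
    rw [real_light hndB hqB, real_light hndB hqB] at h20
    have h20' : cntI (witB b03 b13 b04 b45) 0 ≤ cntI (witB b03 b13 b04 b45) 2 := by exact_mod_cast h20
    exact absurd h20' (not_le.2 hF2)

/-- **The non-adjacent champion-shift condition (ML-na) is FALSE.**  The negated statement is the hypothesis
`hML` of `setCS_of_MLna` / `cumulativeIsolation_of_MLna` / `noHeavyLowerTail_of_MLna`
(`PercNearOneGluingNoHeavyLowerTailCILInductionNonAdjacent.lean`) universally quantified over the vertex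
count `n`, the relay set `A` and the level `j`; it fails at `n = 6`, `A = {0,1,2}`, `j = 1` (`not_MLna_six`).
Consequence for the route: the reductions through (ML-na) (and through the stronger (ML) of `…CILInduction`)
are vacuous; set-champion stability `CS`, the cumulative isolation lemma `stub_cumulativeIsolation` and the crux
`NoHeavyLowerTail` are NOT refuted (they hold at the witness). [this file] -/
theorem not_MLna :
    ¬ (∀ (n : ℕ) (A : Finset (Fin n)) (j : ℕ) (w : Sym2 (Fin n) → unitInterval) (S : Finset (Fin n)) (c : Fin n),
      Disjoint S A → 2 ≤ S.card → c ∈ A →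
      (∀ a ∈ A, (prodBernoulli w).real {ω : BondConfig (Fin n) | (A.filter fun z => ω ∈ openConn a z).card ≤ j} ≤
        (prodBernoulli w).real {ω : BondConfig (Fin n) | (A.filter fun z => ω ∈ openConn c z).card ≤ j}) →
      (∀ v ∈ S, (prodBernoulli w).real {ω : BondConfig (Fin n) | (A.filter fun z => ω ∈ openConn c z).card ≤ j} <
        (prodBernoulli w).real {ω : BondConfig (Fin n) | (A.filter fun z => ω ∈ openConn v z).card ≤ j}) →
      (∃ v ∈ S, ∃ y, y ∉ S ∧ w s(v, y) ≠ 0) →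
      (∀ v ∈ S, w s(c, v) = 0) →
      ∃ F : Finset (Sym2 (Fin n)), F.Nonempty ∧ (∀ e ∈ F, w e ≠ 0 ∧ ∃ v ∈ S, ∃ y, y ≠ v ∧ e = s(v, y)) ∧
        ∃ cF ∈ A,
          (∀ a ∈ A,
            (prodBernoulli (fun e => if e ∈ F then 0 else w e)).real
                {ω : BondConfig (Fin n) | (A.filter fun z => ω ∈ openConn a z).card ≤ j} ≤
              (prodBernoulli (fun e => if e ∈ F then 0 else w e)).real
                {ω : BondConfig (Fin n) | (A.filter fun z => ω ∈ openConn cF z).card ≤ j}) ∧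
          (prodBernoulli w).real {ω : BondConfig (Fin n) | (∀ y ∈ S, ω ∉ openConn cF y) ∧
                (A.filter fun z => ω ∈ openConn cF z).card ≤ j} +
              (prodBernoulli w).real {ω : BondConfig (Fin n) | (∃ y ∈ S, ω ∈ openConn cF y) ∧
                (A.filter fun z => ∃ y ∈ S, ω ∈ openConn y z).card ≤ j} ≤
            (prodBernoulli w).real {ω : BondConfig (Fin n) | (∀ y ∈ S, ω ∉ openConn c y) ∧
                (A.filter fun z => ω ∈ openConn c z).card ≤ j} +
              (prodBernoulli w).real {ω : BondConfig (Fin n) | (∃ y ∈ S, ω ∈ openConn c y) ∧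
                (A.filter fun z => ∃ y ∈ S, ω ∈ openConn y z).card ≤ j}) := by
  intro h
  exact not_MLna_six (h 6 {0, 1, 2} 1)

end Summit.CriticalPhenomena.PercolationContinuityZ3.Theorems
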